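import Literature.Analysis.FluidPDE.BourgainPavlovicRemainder
import Literature.Analysis.FluidPDE.NSKatoToClayHolds
import HarnessLib

/-!
# Continuation of the Bourgain–Pavlović solution up to the inflation time

Tenth support file for the discharge of the barrier
`Literature.Barriers.NavierStokesRegularity.CriticalBesovNormInflation` (Bourgain–Pavlović 2008,
Thm. 1.1). Bourgain–Pavlović take the existence of the smooth solution on `[0, T]` for granted
("the solution exists on this time interval", §3.3); here it is **proved**, by the restart
induction of `exists_isTaoSolutionOn_of_hasGlobalKatoSolution'` (`NSKatoToClayHolds`) with the
energy/enstrophy control of the Fourier weights replaced by the path-norm control of the remainder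
(`BourgainPavlovicRemainder.remainder_pathNorm_le`): along any Fourier-side mild solution `V` from
the datum on `[0, F] ⊆ [0, T]`, the `L²_t L¹_ξ` mass of `V` on every window of length `τ` is
bounded by `3 (τ (M_U² + M₁²) + 4 ε²)` (`window_bound`: `massL1 V ≤ massL1 y + M_U + M₁` and
`∫ massL1(y)² ≤ Z_∞ Z₁ ≤ 4ε²`), which for `τ` and `ε` small is the window hypothesis of the
tree's doubling lemma `IsFourierMild.hasDecay_uniform`; the order-`4` weights of `V` are therefore
uniformly bounded on `[0, T]`, the Fourier–Picard lifespan is uniform, and the restart induction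
reaches `T` (`exists_taoSolution`): a Tao-class (hence classical) solution `(u, p)` on
`[0, T] × ℝ³` from `u₀ = synthVel a₀` with Fourier side `V`, mild on `[0, T]`, `u t = synthVel (V t)`,
and uniform order-`4` weights.

## References

* J. Bourgain, N. Pavlović, J. Funct. Anal. 255 (2008), §3.3. [BourgainPavlovic2008]
-/

noncomputable section

open MeasureTheory Real Set Filter Topology Function Complex
open scoped ENNReal NNReal ComplexConjugate

namespace Literature.Analysis.FluidPDE.BourgainPavlovic

open FourierNS Literature.Analysis.FunctionSpaces

/-- Local notation for frequency space `ℝ³`. -/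
local notation "E3" => EuclideanSpace ℝ (Fin 3)

namespace InflationParams

variable (d : InflationParams)

/-! ### Real masses -/

/-- `finrank ℝ³ = 3 < 4`. [folklore] -/
theorem finrank_lt_four : Module.finrank ℝ E3 < 4 := by
  rw [finrank_euclideanSpace, Fintype.card_fin]; norm_num

/-- **The mass of a field with an order-`4` weight is finite**: `massL1 Φ ≤ A · I₄ < ∞`. [folklore] -/
theorem massL1_le_of_hasDecay {A : ℝ} {Φ : E3 → Fin 3 → ℂ} (h : HasDecay 4 A Φ) :
    massL1 Φ ≤ ENNReal.ofReal (A * weightMass E3 4) := by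
  have hint : Integrable (fun η : E3 => A * ((1 + ‖η‖) ^ 4)⁻¹) :=
    (integrable_inv_one_add_norm_pow finrank_lt_four).const_mul A
  calc massL1 Φ ≤ ∫⁻ η, ENNReal.ofReal (A * ((1 + ‖η‖) ^ 4)⁻¹) := by
        refine lintegral_mono fun η => ?_
        rw [← ofReal_norm]
        exact ENNReal.ofReal_le_ofReal (h η)
    _ = ENNReal.ofReal (∫ η, A * ((1 + ‖η‖) ^ 4)⁻¹) := by
        rw [ofReal_integral_eq_lintegral_ofReal hint (Eventually.of_forall fun η => by
          have := h.nonneg; positivity)]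
    _ = ENNReal.ofReal (A * weightMass E3 4) := by
        rw [MeasureTheory.integral_const_mul]; rfl

/-- The real mass of an integrable field is the real part of `massL1`. [folklore] -/
theorem integral_norm_eq_toReal_massL1 {Φ : E3 → Fin 3 → ℂ} (hΦ : AEStronglyMeasurable Φ volume) :
    ∫ η, ‖Φ η‖ = (massL1 Φ).toReal :=
  integral_norm_eq_lintegral_enorm hΦ

/-- **The uniform mass of the free evolution**: `massL1 (Uᶜ r) ≤ M_U = ∑_a α (N_a + 2) m`. [folklore] -/
def massU : ℝ := ∑ a ∈ d.idx, d.α * (d.N a.1 + 2) * d.bumpMass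

/-- `M_U ≥ 0`. [folklore] -/
theorem massU_nonneg : 0 ≤ d.massU :=
  Finset.sum_nonneg fun a _ => by
    have := d.α_pos.le; have := d.bumpMass_nonneg; have := (d.N_pos a.1).le; positivity

/-- `massL1 (Uᶜ r) ≤ M_U`. [folklore] -/
theorem massL1_freeC_le_massU (r : ℝ) : massL1 (d.freeC r) ≤ ENNReal.ofReal d.massU := by
  refine (d.massL1_freeC_le r).trans ?_
  rw [massU, ENNReal.ofReal_sum_of_nonneg (fun a _ => by
    have := d.α_pos.le; have := d.bumpMass_nonneg; have := (d.N_pos a.1).le; positivity)]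
  refine Finset.sum_le_sum fun a _ => (d.massL1_freePieceC_le a r).trans (ENNReal.ofReal_le_ofReal ?_)
  have hα := d.α_pos.le; have hm := d.bumpMass_nonneg; have hN := (d.N_pos a.1).le
  have : Real.exp (-(2 * π ^ 2 * d.N a.1 ^ 2) * max r 0) ≤ 1 := by
    rw [Real.exp_le_one_iff]
    have : 0 ≤ 2 * π ^ 2 * d.N a.1 ^ 2 * max r 0 := by positivity
    linarith
  calc d.α * (d.N a.1 + 2) * d.bumpMass * Real.exp (-(2 * π ^ 2 * d.N a.1 ^ 2) * max r 0)
      ≤ d.α * (d.N a.1 + 2) * d.bumpMass * 1 := mul_le_mul_of_nonneg_left this (by positivity)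
    _ = _ := mul_one _

/-- **The uniform mass of the second iterate**:
`M₁ = 8r · 6 α² m² + ∑_{high pairs} 45 α² m² N_min`. [folklore] -/
def massOne : ℝ := ∑ _p ∈ d.lowPairs, 6 * d.α ^ 2 * d.bumpMass ^ 2 +
  ∑ p ∈ d.highPairs, 45 * d.α ^ 2 * d.bumpMass ^ 2 * min (d.N p.1.1) (d.N p.2.1)

/-- `M₁ ≥ 0`. [folklore] -/
theorem massOne_nonneg : 0 ≤ d.massOne := by
  have := d.α_pos.le; have := d.bumpMass_nonneg
  refine add_nonneg (Finset.sum_nonneg fun p _ => by positivity) (Finset.sum_nonneg fun p _ => ?_)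
  have := (d.N_pos p.1.1).le; have := (d.N_pos p.2.1).le; positivity

/-- `massL1 (u₁ᶜ r) ≤ M₁` for all `r`. [folklore] -/
theorem massL1_u1C_le_massOne (r : ℝ) : massL1 (d.u1C r) ≤ ENNReal.ofReal d.massOne := by
  have hα := d.α_pos.le; have hm := d.bumpMass_nonneg
  have hr0 : 0 ≤ max r 0 := le_max_right _ _
  rw [u1C]
  refine (d.massL1_secondIterate_le_pairs (max r 0)).trans ?_
  rw [massOne, ENNReal.ofReal_add (Finset.sum_nonneg fun p _ => by positivity)
    (Finset.sum_nonneg fun p _ => by have := (d.N_pos p.1.1).le; have := (d.N_pos p.2.1).le; positivity),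
    ENNReal.ofReal_sum_of_nonneg (fun p _ => by positivity),
    ENNReal.ofReal_sum_of_nonneg (fun p _ => by have := (d.N_pos p.1.1).le; have := (d.N_pos p.2.1).le; positivity)]
  refine add_le_add (Finset.sum_le_sum fun p hp => ?_) (Finset.sum_le_sum fun p hp => ?_)
  · exact d.massL1_pairTerm_le_of_low (Finset.mem_filter.1 hp).2 hr0
  · refine (d.massL1_pairTerm_le_of_not_low (Finset.mem_filter.1 hp).2 hr0).trans (ENNReal.ofReal_le_ofReal ?_)
    have h1 : 0 ≤ min (d.N p.1.1) (d.N p.2.1) := le_min (d.N_pos _).le (d.N_pos _).le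
    have : Real.exp (-(π ^ 2 * max (d.N p.1.1) (d.N p.2.1) ^ 2) * max r 0) ≤ 1 := by
      rw [Real.exp_le_one_iff]
      have : 0 ≤ π ^ 2 * max (d.N p.1.1) (d.N p.2.1) ^ 2 * max r 0 := by positivity
      linarith
    calc 45 * d.α ^ 2 * d.bumpMass ^ 2 * min (d.N p.1.1) (d.N p.2.1) *
          Real.exp (-(π ^ 2 * max (d.N p.1.1) (d.N p.2.1) ^ 2) * max r 0)
        ≤ 45 * d.α ^ 2 * d.bumpMass ^ 2 * min (d.N p.1.1) (d.N p.2.1) * 1 :=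
          mul_le_mul_of_nonneg_left this (by positivity)
      _ = _ := mul_one _

/-! ### The window bound -/

/-- **The `L²_t L¹_ξ` window bound along a controlled solution.** For a Fourier-side mild solution
`V` on `[0, F]` from the datum, `0 < F ≤ T`, under the bootstrap hypotheses: for
`0 ≤ s ≤ t ≤ F`, `∫ₛᵗ (∫‖V r‖)² dr ≤ 3 ((t − s)(M_U² + M₁²) + 4 ε(T)²)`. [cite: BourgainPavlovic2008, §3.3] -/
theorem window_bound {T F : ℝ} (hF : 0 < F) (hFT : F ≤ T)
    {V : ℝ → E3 → Fin 3 → ℂ} (hV : IsFourierMild (4 * π ^ 2) 4 0 F V) (hV0 : V 0 = d.datum)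
    (hlin : 4 * d.linCoef T ≤ 1) (hforc : 16 * CG * d.forcing T ≤ 1)
    {s t : ℝ} (hs : 0 ≤ s) (hst : s ≤ t) (htF : t ≤ F) :
    ∫ r in s..t, (∫ η, ‖V r η‖) ^ 2 ≤
      3 * ((t - s) * (d.massU ^ 2 + d.massOne ^ 2) + 4 * (d.forcing T).toReal ^ 2) := by
  set y := d.remainder V with hy
  have hyc : Continuous (uncurry y) := d.continuous_remainder hV.cont
  obtain ⟨A4, hA4⟩ := d.hasDecay_remainder (K := 4) (hV.decay 4)
  obtain ⟨AV, hAV⟩ := hV.decay 4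
  -- the path-norm control
  have hZ : pathNorm F y ≤ 2 * d.forcing T := d.remainder_pathNorm_le hF hFT hV hV0 hlin hforc
  have hε_lt : d.forcing T < ⊤ := by
    rw [forcing]
    exact ENNReal.mul_lt_top CG_lt_top (ENNReal.add_lt_top.2
      ⟨ENNReal.mul_lt_top (by norm_num) ENNReal.ofReal_lt_top, ENNReal.ofReal_lt_top⟩)
  have hZ_lt : pathNorm F y < ⊤ := lt_of_le_of_lt hZ (ENNReal.mul_lt_top (by norm_num) hε_lt)
  -- real masses
  set mV : ℝ → ℝ := fun r => (massL1 (V r)).toReal with hmV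
  set my : ℝ → ℝ := fun r => (massL1 (y r)).toReal with hmy
  have hVr : ∀ r, ∫ η, ‖V r η‖ = mV r := fun r =>
    integral_norm_eq_toReal_massL1 (hV.continuous_slice r).aestronglyMeasurable
  have hmassV_lt : ∀ r, massL1 (V r) < ⊤ := fun r =>
    lt_of_le_of_lt (massL1_le_of_hasDecay (hAV r)) ENNReal.ofReal_lt_top
  have hmassy_le : ∀ r, massL1 (y r) ≤ ENNReal.ofReal (A4 * weightMass E3 4) := fun r =>
    massL1_le_of_hasDecay (hA4 r)
  have hMy0 : 0 ≤ A4 * weightMass E3 4 := mul_nonneg (hA4 0).nonneg (weightMass_nonneg 4)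
  -- pointwise: `mV ≤ my + M_U + M₁`
  have hsplit : ∀ r, mV r ≤ my r + d.massU + d.massOne := by
    intro r
    have h1 : massL1 (V r) ≤ massL1 (y r) + massL1 (d.freeC r) + massL1 (d.u1C r) :=
      massL1_le_add_three (hyc.uncurry_left r) (d.continuous_freeC.uncurry_left r) fun ξ => by
        simp only [hy, remainder]; ring
    have h2 : massL1 (V r) ≤ massL1 (y r) + ENNReal.ofReal d.massU + ENNReal.ofReal d.massOne :=
      h1.trans (add_le_add (add_le_add le_rfl (d.massL1_freeC_le_massU r)) (d.massL1_u1C_le_massOne r))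
    have hy_ne : massL1 (y r) ≠ ⊤ := (lt_of_le_of_lt (hmassy_le r) ENNReal.ofReal_lt_top).ne
    have h3 := ENNReal.toReal_mono (by
      exact ENNReal.add_ne_top.2 ⟨ENNReal.add_ne_top.2 ⟨hy_ne, ENNReal.ofReal_ne_top⟩, ENNReal.ofReal_ne_top⟩) h2
    rw [ENNReal.toReal_add (ENNReal.add_ne_top.2 ⟨hy_ne, ENNReal.ofReal_ne_top⟩) ENNReal.ofReal_ne_top,
      ENNReal.toReal_add hy_ne ENNReal.ofReal_ne_top, ENNReal.toReal_ofReal d.massU_nonneg,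
      ENNReal.toReal_ofReal d.massOne_nonneg] at h3
    exact h3
  -- pointwise square
  have hsq : ∀ r, mV r ^ 2 ≤ 3 * (my r ^ 2 + d.massU ^ 2 + d.massOne ^ 2) := by
    intro r
    have h0 : 0 ≤ mV r := ENNReal.toReal_nonneg
    have h1 := hsplit r
    nlinarith [sq_nonneg (my r - d.massU), sq_nonneg (my r - d.massOne), sq_nonneg (d.massU - d.massOne),
      sq_nonneg (mV r), mul_self_le_mul_self h0 h1]
  -- measurability and boundedness of `my`
  have hmy_meas : Measurable my := (measurable_massL1 hyc).ennreal_toReal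
  have hmy_bd : ∀ r, my r ≤ A4 * weightMass E3 4 := fun r => by
    have := ENNReal.toReal_mono ENNReal.ofReal_ne_top (hmassy_le r)
    rwa [ENNReal.toReal_ofReal hMy0] at this
  have hmy0 : ∀ r, 0 ≤ my r := fun r => ENNReal.toReal_nonneg
  have hint_g : IntegrableOn (fun r => 3 * (my r ^ 2 + d.massU ^ 2 + d.massOne ^ 2)) (Ioc s t) := by
    refine Integrable.const_mul ?_ 3
    refine ((Integrable.add ?_ (integrableOn_const (by rw [Real.volume_Ioc]; exact ENNReal.ofReal_ne_top)))).add
      (integrableOn_const (by rw [Real.volume_Ioc]; exact ENNReal.ofReal_ne_top))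
    refine Measure.integrableOn_of_bounded (M := (A4 * weightMass E3 4) ^ 2) ?_
      ((hmy_meas.pow_const 2).aestronglyMeasurable) (Eventually.of_forall fun r => ?_)
    · rw [Real.volume_Ioc]; exact ENNReal.ofReal_ne_top
    · rw [Real.norm_eq_abs, abs_of_nonneg (sq_nonneg _)]
      exact pow_le_pow_left₀ (hmy0 r) (hmy_bd r) 2
  -- the integral of `my²` against the path norm
  have hmy_sq : ∫ r in Ioc s t, my r ^ 2 ≤ 4 * (d.forcing T).toReal ^ 2 := by
    have hnn : 0 ≤ᵐ[volume.restrict (Ioc s t)] fun r => my r ^ 2 := Eventually.of_forall fun r => sq_nonneg _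
    have hfi : IntegrableOn (fun r => my r ^ 2) (Ioc s t) := by
      refine Measure.integrableOn_of_bounded (M := (A4 * weightMass E3 4) ^ 2) ?_
        ((hmy_meas.pow_const 2).aestronglyMeasurable) (Eventually.of_forall fun r => ?_)
      · rw [Real.volume_Ioc]; exact ENNReal.ofReal_ne_top
      · rw [Real.norm_eq_abs, abs_of_nonneg (sq_nonneg _)]
        exact pow_le_pow_left₀ (hmy0 r) (hmy_bd r) 2
    rw [integral_eq_lintegral_of_nonneg_ae hnn hfi.aestronglyMeasurable]
    -- compare the lintegral with `∫⁻ massL1²` on `(0, F]`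
    have h1 : ∫⁻ r in Ioc s t, ENNReal.ofReal (my r ^ 2) ≤ ∫⁻ r in Ioc 0 F, massL1 (y r) * massL1 (y r) := by
      calc ∫⁻ r in Ioc s t, ENNReal.ofReal (my r ^ 2) ≤ ∫⁻ r in Ioc 0 F, ENNReal.ofReal (my r ^ 2) :=
            lintegral_mono_set (Ioc_subset_Ioc hs htF)
        _ = ∫⁻ r in Ioc 0 F, massL1 (y r) * massL1 (y r) := by
            refine lintegral_congr fun r => ?_
            have hne : massL1 (y r) ≠ ⊤ := (lt_of_le_of_lt (hmassy_le r) ENNReal.ofReal_lt_top).ne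
            rw [hmy]; dsimp only
            rw [sq, ENNReal.ofReal_mul ENNReal.toReal_nonneg, ENNReal.ofReal_toReal hne]
    have h2 : ∫⁻ r in Ioc 0 F, massL1 (y r) * massL1 (y r) ≤ 2 * d.forcing T * (2 * d.forcing T) :=
      (lintegral_massL1_mul_self_le F hyc).trans
        (mul_le_mul' (pathNormInf_le_pathNorm.trans hZ) (pathNormOne_le_pathNorm.trans hZ))
    have h3 := ENNReal.toReal_mono (ENNReal.mul_ne_top (ENNReal.mul_ne_top ENNReal.ofNat_ne_top hε_lt.ne)
      (ENNReal.mul_ne_top ENNReal.ofNat_ne_top hε_lt.ne)) (h1.trans h2)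
    refine h3.trans (le_of_eq ?_)
    simp only [ENNReal.toReal_mul, ENNReal.toReal_ofNat]
    ring
  -- assemble
  calc ∫ r in s..t, (∫ η, ‖V r η‖) ^ 2 = ∫ r in Ioc s t, mV r ^ 2 := by
        rw [intervalIntegral.integral_of_le hst]
        exact integral_congr_ae (Eventually.of_forall fun r => by
          show (∫ η, ‖V r η‖) ^ 2 = mV r ^ 2
          rw [hVr r])
    _ ≤ ∫ r in Ioc s t, 3 * (my r ^ 2 + d.massU ^ 2 + d.massOne ^ 2) :=
        integral_mono_of_nonneg (Eventually.of_forall fun r => sq_nonneg _) hint_g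
          (Eventually.of_forall fun r => hsq r)
    _ = 3 * ((∫ r in Ioc s t, my r ^ 2) + (t - s) * (d.massU ^ 2 + d.massOne ^ 2)) := by
        rw [MeasureTheory.integral_const_mul]
        congr 1
        have hfi : IntegrableOn (fun r => my r ^ 2) (Ioc s t) := by
          refine Measure.integrableOn_of_bounded (M := (A4 * weightMass E3 4) ^ 2) ?_
            ((hmy_meas.pow_const 2).aestronglyMeasurable) (Eventually.of_forall fun r => ?_)
          · rw [Real.volume_Ioc]; exact ENNReal.ofReal_ne_top
          · rw [Real.norm_eq_abs, abs_of_nonneg (sq_nonneg _)]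
            exact pow_le_pow_left₀ (hmy0 r) (hmy_bd r) 2
        rw [show (fun r => my r ^ 2 + d.massU ^ 2 + d.massOne ^ 2) =
          fun r => my r ^ 2 + (d.massU ^ 2 + d.massOne ^ 2) by funext r; ring]
        rw [integral_add hfi (integrableOn_const (by rw [Real.volume_Ioc]; exact ENNReal.ofReal_ne_top)),
          setIntegral_const, Real.volume_real_Ioc_of_le hst, smul_eq_mul]
    _ ≤ 3 * (4 * (d.forcing T).toReal ^ 2 + (t - s) * (d.massU ^ 2 + d.massOne ^ 2)) := by
        gcongr
    _ = _ := by ring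

/-! ### The solution up to time `T` -/

/-- **Existence and control of the Bourgain–Pavlović solution on `[0, T]`.** Under the bootstrap
hypotheses `4λ(T) ≤ 1`, `16 C_G ε(T) ≤ 1` and the window smallness
`12 · decayWindowConst² · ε(T)² ≤ π²`, the datum `u₀ = synthVel a₀` has a Tao-class solution
`(u, p)` on `[0, T] × ℝ³` with a Fourier side `V`, mild on `[0, T]`, `u t = synthVel (V t)`,
`V 0 = a₀`, and uniformly bounded order-`4` weights (restart induction of `NSKatoToClayHolds`
with the path-norm window bound). [cite: BourgainPavlovic2008, §3.3 ("the solution exists on this time interval")] -/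
theorem exists_taoSolution {T : ℝ} (hT : 0 < T) (hlin : 4 * d.linCoef T ≤ 1)
    (hforc : 16 * CG * d.forcing T ≤ 1)
    (hwin : 12 * decayWindowConst (Fin 3) 4 ^ 2 * (d.forcing T).toReal ^ 2 ≤ π ^ 2) :
    ∃ (A : ℝ) (u : ℝ → E3 → E3) (p : ℝ → E3 → ℝ) (V : ℝ → E3 → Fin 3 → ℂ),
      IsTaoSolutionOn T 1 (synthVel d.datum) u p ∧ IsFourierMild (4 * π ^ 2) 4 0 T V ∧
      (∀ t ∈ Icc 0 T, u t = synthVel (V t)) ∧ V 0 = d.datum ∧ (∀ t ∈ Icc 0 T, HasDecay 4 A (V t)) := by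
  have e1 : (4 : ℝ) * π ^ 2 * 1 = 4 * π ^ 2 := by ring
  have e2 : Fintype.card (Fin 3) + 1 = 4 := by simp
  set cF : ℝ := 4 * π ^ 2 with hcF
  have hcF0 : 0 < cF := by positivity
  /- the window -/
  set W : ℝ := decayWindowConst (Fin 3) 4 with hW
  have hW0 : 0 ≤ W := decayWindowConst_nonneg (ι := Fin 3) 4
  set S : ℝ := d.massU ^ 2 + d.massOne ^ 2 with hS
  have hS0 : 0 ≤ S := by positivity
  set τ : ℝ := π ^ 2 / (3 * W ^ 2 * S + 1) with hτ
  have hτ0 : 0 < τ := by positivity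
  set εr : ℝ := (d.forcing T).toReal with hεr
  set G : ℝ := 3 * (τ * S + 4 * εr ^ 2) with hG
  have hsmall : W ^ 2 * G ≤ cF / 2 := by
    have h1 : 3 * W ^ 2 * S * τ ≤ π ^ 2 := by
      rw [hτ, mul_div_assoc', div_le_iff₀ (by positivity)]
      nlinarith [mul_nonneg (mul_nonneg (by norm_num : (0:ℝ) ≤ 3) (sq_nonneg W)) hS0, Real.pi_pos]
    have h2 : W ^ 2 * (12 * εr ^ 2) ≤ π ^ 2 := by rw [hW, hεr]; linarith
    rw [hG, hcF]
    nlinarith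
  /- the initial Fourier datum and the uniform weight -/
  set A₀ : ℝ := 4 * d.α * d.r * d.suppRadius * (1 + d.suppRadius) ^ 4 with hA₀
  have hA₀dec : HasDecay 4 A₀ d.datum := d.hasDecay_datum 4
  have hA₀0 : 0 ≤ A₀ := hA₀dec.nonneg
  set Aunif : ℝ := 2 ^ ⌈T / τ⌉₊ * A₀ with hAunif
  have hAunif0 : 0 ≤ Aunif := by positivity
  set TP : ℝ := picardTime (Fin 3) cF 4 (2 * Aunif) with hTP
  have hTPpos : 0 < TP := picardTime_pos hcF0 _ _ (by positivity)
  set u₀ : E3 → E3 := synthVel d.datum with hu₀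
  /- the state of the induction -/
  set State : ℝ → (ℝ → E3 → E3) → (ℝ → E3 → ℝ) → (ℝ → E3 → Fin 3 → ℂ) → Prop :=
    fun F u p V => IsTaoSolutionOn F 1 u₀ u p ∧ IsFourierMild cF 4 0 F V ∧
      (∀ t ∈ Icc 0 F, u t = synthVel (V t)) ∧ V 0 = d.datum with hState
  /- uniform weights for a state on `[0, F]`, `F ≤ T` -/
  have hbounds : ∀ ⦃F : ℝ⦄ ⦃u : ℝ → E3 → E3⦄ ⦃p : ℝ → E3 → ℝ⦄ ⦃V : ℝ → E3 → Fin 3 → ℂ⦄,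
      0 < F → F ≤ T → State F u p V → ∀ t' ∈ Icc 0 F, HasDecay 4 Aunif (V t') := by
    intro F u p V hF hFT hSt t' ht'
    obtain ⟨_, hV, _, hV0⟩ := hSt
    have hVA₀ : HasDecay 4 A₀ (V 0) := by rw [hV0]; exact hA₀dec
    have hwin' : ∀ s ∈ Icc 0 F, ∀ t ∈ Icc s F, t - s ≤ τ → ∫ r in s..t, (∫ η, ‖V r η‖) ^ 2 ≤ G := by
      intro s hs t ht hts
      refine (d.window_bound hF hFT hV hV0 hlin hforc hs.1 ht.1 ht.2).trans ?_
      rw [hG]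
      have : (t - s) * S ≤ τ * S := mul_le_mul_of_nonneg_right hts hS0
      nlinarith
    have hdecay := hV.hasDecay_uniform hVA₀ hτ0 hwin' (by rw [← hW]; exact hsmall) t' ht'
    rw [sub_zero] at hdecay
    refine hdecay.mono (mul_le_mul_of_nonneg_right ?_ hA₀0)
    exact pow_le_pow_right₀ one_le_two (Nat.ceil_le_ceil (div_le_div_of_nonneg_right hFT hτ0.le))
  /- the restart step -/
  have hstep : ∀ ⦃F : ℝ⦄ ⦃u : ℝ → E3 → E3⦄ ⦃p : ℝ → E3 → ℝ⦄ ⦃V : ℝ → E3 → Fin 3 → ℂ⦄,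
      0 < F → F ≤ T → State F u p V →
      ∃ (F' : ℝ) (u' : ℝ → E3 → E3) (p' : ℝ → E3 → ℝ) (V' : ℝ → E3 → Fin 3 → ℂ),
        (T ≤ F' ∨ F + TP / 2 ≤ F') ∧ F' ≤ T ∧ 0 < F' ∧ State F' u' p' V' := by
    intro F u p V hF hFT hSt
    have hdecay := hbounds hF hFT hSt
    obtain ⟨h, hV, hsyn, hV0⟩ := hSt
    set t' : ℝ := max (F / 2) (F - TP / 4) with ht'
    have ht'0 : 0 ≤ t' := le_max_of_le_left (by linarith)
    have ht'F : t' < F := max_lt (by linarith) (by linarith)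
    have hFt' : F ≤ t' + TP := by linarith [le_max_right (F / 2) (F - TP / 4)]
    have ht'I : t' ∈ Icc 0 F := ⟨ht'0, ht'F.le⟩
    -- the restart piece from the Fourier-side state `V t'`
    have hdecAll : ∀ K : ℕ, ∃ B, HasDecay K B (V t') := fun K => by
      obtain ⟨B, hB⟩ := hV.decay K
      exact ⟨B, hB t'⟩
    have hdec4 : HasDecay (Fintype.card (Fin 3) + 1) Aunif (V t') := by rw [e2]; exact hdecay t' ht'I
    obtain ⟨v, q, Wf, hv, hWf, hvsyn, hWf0⟩ := exists_isTaoSolutionOn_fourierPiece one_pos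
      (hV.continuous_slice t') hdecAll hdec4 (hV.divFree t') (hV.conjSymm t')
    rw [e1, e2, ← hTP] at hv hWf
    have hvt' : synthVel (V t') = u t' := (hsyn t' ht'I).symm
    rw [hvt'] at hv
    -- the physical glue
    have hglue := h.glue hv one_pos hTPpos ht'0 ht'F hFt'
    -- the agreement on the overlap
    have hagree : ∀ s ∈ Ico 0 (min (F - t') TP), u (s + t') = v s :=
      (h.translate ht'0 ht'F).eq_of_isTaoSolutionOn hv one_pos (by linarith) hTPpos
    -- the Fourier glue
    have hWf' : IsFourierMild cF 4 t' (t' + TP) (fun t => Wf (t - t')) := by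
      have := hWf.translate t'
      simpa only [zero_add, add_comm TP t'] using this
    have hVt' : IsFourierMild cF 4 0 t' V := hV.mono le_rfl ht'0 ht'F.le
    have hjunction : V t' = (fun t => Wf (t - t')) t' := by simp only [sub_self, hWf0]
    have hGlueF := hVt'.glue hWf' hjunction
    set F' : ℝ := min (t' + TP) T with hF'
    have hF'pos : 0 < F' := lt_min (by linarith) hT
    have hF'le : F' ≤ t' + TP := min_le_left _ _
    refine ⟨F', (fun t => if t < F then u t else v (t - t')),
      (fun t => if t < F then p t else q (t - t')), (fun t => if t ≤ t' then V t else Wf (t - t')),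
      ?_, min_le_right _ _, hF'pos, ?_, ?_, ?_, ?_⟩
    · by_cases hcase : t' + TP ≤ T
      · right; rw [hF', min_eq_left hcase]; linarith [le_max_right (F / 2) (F - TP / 4)]
      · left; rw [hF', min_eq_right (le_of_not_ge hcase)]
    · exact hglue.mono hF'pos hF'le
    · exact hGlueF.mono le_rfl hF'pos.le hF'le
    · -- synthesis at every time of `[0, F']`
      intro t ht
      by_cases htt' : t ≤ t'
      · have htF : t < F := lt_of_le_of_lt htt' ht'F
        simp only [if_pos htF, if_pos htt']
        exact hsyn t ⟨ht.1, htF.le⟩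
      · have hgt : t' < t := not_le.1 htt'
        simp only [if_neg htt']
        by_cases htF : t < F
        · simp only [if_pos htF]
          have hs : t - t' ∈ Ico 0 (min (F - t') TP) :=
            ⟨by linarith, lt_min (by linarith) (by linarith [ht.2])⟩
          have := hagree (t - t') hs
          rw [sub_add_cancel] at this
          rw [this, hvsyn]
        · simp only [if_neg htF]
          exact hvsyn (t - t')
    · -- the initial Fourier datum is unchanged
      show (if (0 : ℝ) ≤ t' then V 0 else Wf (0 - t')) = d.datum
      rw [if_pos ht'0, hV0]
  /- the first state -/
  have hbase : ∃ (F : ℝ) (u : ℝ → E3 → E3) (p : ℝ → E3 → ℝ) (V : ℝ → E3 → Fin 3 → ℂ),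
      0 < F ∧ F ≤ T ∧ State F u p V := by
    have hA₀' : HasDecay (Fintype.card (Fin 3) + 1) A₀ d.datum := by rw [e2]; exact hA₀dec
    obtain ⟨u, p, V, hu, hV, hsyn, hV0⟩ := exists_isTaoSolutionOn_fourierPiece one_pos
      d.continuous_datum d.hasDecay_datum_all hA₀' d.sum_mul_datum d.datum_conj_symm
    rw [e1, e2] at hu hV
    set T₀ : ℝ := picardTime (Fin 3) cF 4 (2 * A₀) with hT₀
    have hT₀pos : 0 < T₀ := picardTime_pos hcF0 _ _ (by positivity)
    set F₀ : ℝ := min T₀ T with hF₀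
    have hF₀pos : 0 < F₀ := lt_min hT₀pos hT
    refine ⟨F₀, u, p, V, hF₀pos, min_le_right _ _, ?_, ?_, ?_, hV0⟩
    · exact hu.mono hF₀pos (min_le_left _ _)
    · exact hV.mono le_rfl hF₀pos.le (min_le_left _ _)
    · exact fun t _ => hsyn t
  /- the induction -/
  have hiter : ∀ k : ℕ, ∃ (F : ℝ) (u : ℝ → E3 → E3) (p : ℝ → E3 → ℝ) (V : ℝ → E3 → Fin 3 → ℂ),
      0 < F ∧ F ≤ T ∧ State F u p V ∧ (T ≤ F ∨ (k : ℝ) * (TP / 2) ≤ F) := by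
    intro k
    induction k with
    | zero =>
      obtain ⟨F, u, p, V, hF, hFw, hSt⟩ := hbase
      exact ⟨F, u, p, V, hF, hFw, hSt, Or.inr (by simpa using hF.le)⟩
    | succ k ih =>
      obtain ⟨F, u, p, V, hF, hFw, hSt, halt⟩ := ih
      rcases le_or_gt T F with hdone | hlt
      · exact ⟨F, u, p, V, hF, hFw, hSt, Or.inl hdone⟩
      · obtain ⟨F', u', p', V', hprog, hF'w, hF'pos, hSt'⟩ := hstep hF hlt.le hSt
        refine ⟨F', u', p', V', hF'pos, hF'w, hSt', ?_⟩
        rcases hprog with hT' | hadv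
        · exact Or.inl hT'
        · rcases halt with hd | hk
          · exact absurd hd (not_le.2 hlt)
          · right
            push_cast
            linarith
  obtain ⟨k, hk⟩ := exists_nat_gt (T / (TP / 2))
  obtain ⟨F, u, p, V, hF, hFT, hSt, halt⟩ := hiter k
  have hTF : T ≤ F := by
    rcases halt with hd | hk'
    · exact hd
    · exfalso
      have h2 : T < (k : ℝ) * (TP / 2) := by rwa [div_lt_iff₀ (by positivity)] at hk
      linarith
  have hFeq : F = T := le_antisymm hFT hTF
  have hdec := hbounds hF hFT hSt
  obtain ⟨h, hV, hsyn, hV0⟩ := hSt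
  subst hFeq
  exact ⟨Aunif, u, p, V, h, hV, hsyn, hV0, hdec⟩

end InflationParams

end Literature.Analysis.FluidPDE.BourgainPavlovic
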